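import Summits.HodgeConjecture.CorCM.PairFlipCMFieldOffClosureHodge
import Summits.HodgeConjecture.CorCM.SimpleCMProductsDimLeThreeHodge
import HarnessLib

/-!
# Pair-flip slots SPLIT OFF: in a family of CM types, the slots whose CM fields have pair flips (generic CM fields of any
# degree) and whose Galois closures are pairwise distinct and not inside the other closures can be removed without
# changing nondegeneracy — products of generic CM abelian varieties of ANY dimensions with distinct closures

COR-CM (cell `pub-hodgecm2`, binder seat `b16` gen 44, count-neutral claim CM-DIMLE3-INTRINSIC, file F5; theorems only, no
definition, no named fact, no `sorry`).  NEW as stated, hence under `Summits/`.  HONEST FRAMING: an unconditional theorem on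
products of CM abelian varieties of arbitrary dimensions; not a step of the summit chain (`HC_CM` is neither used nor
advanced).  The n-ary form of `CorCM/PairFlipCMFieldOffClosureHodge` (F4, the pair).

SETTING.  A finite family `(K_i; Φ_i)_{i ∈ I}` of CM types and a set `p ⊆ I` of PAIR-FLIP SLOTS: for `i ∈ p` every conjugate
pair of complex embeddings of `K_i` is exchanged by an automorphism of `ℂ` fixing the other embeddings (generic CM fields of
every degree `2g`, Galois group `C₂ ≀ 𝔖_g`; all sextic CM fields with closure of degree `24`/`48`; every imaginary quadratic
field).  HYPOTHESES on the Galois closures `L_i ≤ ℂ`: (h1) two different pair-flip slots have DIFFERENT closures;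
(h2) the closure of a pair-flip slot is not contained in the closure of a slot outside `p`.  Then (criterion (κ) of seat
b16 gen 43, `pairwise_of_irreducible_of_not_normalClosure_le`, applied from the side whose closure is not contained in the
other — `U(Φ_i)` is irreducible and `Φ_i` nondegenerate on a pair-flip slot) no pair-flip slot shares a constituent with
any other slot, and by the block criterion (`isNondegenerateFamily_of_fibers`, blocks = the single pair-flip slots and the
rest):

* §1 **`isNondegenerateFamily_iff_of_pairFlip_slots`** — `(Φ_i)_i` is nondegenerate IFF the sub-family OUTSIDE `p` is
  (vacuous if `p = I`): generic slots with distinct closures split off.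
* §2 **`isNondegenerateFamily_pairFlip_of_normalClosure_ne`** — ALL slots pair-flip with pairwise distinct closures ⟹
  nondegenerate: `Hg(∏ A_i) = ∏ Hg(A_i)` for CM abelian varieties of ANY dimensions `g_i` with generic CM fields and pairwise
  distinct Galois closures (so far the tree had this for dimension `≤ 3`, `CorCM/SimpleCMDistinctClosuresHodge`, and for
  linearly disjoint fields); **`hodgeConjectureFor_prod_pairFlip_of_normalClosure_ne`** — the Hodge conjecture with `B• = D•` on
  every `⨁_{j<N} A_{π j}`, UNCONDITIONALLY; for simple non-isogenous realisations no product carries an exceptional class.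
* §3 geometry of §1: **`hodgeConjectureFor_prod_of_pairFlip_slots`** — the Hodge conjecture on all products as soon as the
  sub-family outside `p` is nondegenerate (e.g. decided by the dimension-`≤ 3` census, or a single nondegenerate simple CM
  fourfold as in F4).

## References

* [Gordon1999HodgeAVSurvey] B. B. Gordon, *A survey of the Hodge conjecture for abelian varieties*, §3 Theorem, 7.4–7.7,
  10.10.
* [Dodson1984] B. Dodson, *The structure of Galois groups of CM-fields*, Trans. AMS 283 (1984), §1.1 (the generic Galois
  group `C₂ ≀ 𝔖_g`), §5.1.2.
* [MoonenZarhin1999LowDim] B. Moonen, Yu. Zarhin, *Hodge classes on abelian varieties of low dimension*, Math. Ann. 315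
  (1999), §3 (3.1).
* [Lang2002] S. Lang, *Algebra*, GTM 211, V §1 Prop. 1.2, VI §1 Thm. 1.1.
-/

noncomputable section

open CategoryTheory CategoryTheory.Limits NumberField Module IntermediateField

namespace Summit.HodgeConjecture.CorCM

open Literature.NumberTheory.ComplexMultiplication
open Literature.AlgebraicGeometry.Motives (AbelianVariety CMType)
open Literature.AlgebraicGeometry.HodgeTheory
open Literature.AlgebraicGeometry.ComplexMultiplication (IsCMTypeRealisation isSimple_iff_isPrimitive)
open Literature.AlgebraicGeometry.VanGeemen1994 (hodgeClassSpan)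
open Literature.AlgebraicGeometry.Pohlmann1968
open Literature.Barriers.HodgeConjecture (divisorClassesSpan)

variable {I : Type} {K : I → Type} [∀ i, Field (K i)] [∀ i, NumberField (K i)] [∀ i, IsCMField (K i)] [Fintype I]
  [DecidableEq I] {Φ : ∀ i, CMType (K i)}

/-! ## §1 Types: pair-flip slots with distinct closures split off -/

section Types

variable [Nonempty I]

/-- **PAIR-FLIP SLOTS SPLIT OFF.**  Let `p ⊆ I` consist of pair-flip slots such that (h1) different pair-flip slots have
different Galois closures and (h2) the closure of a pair-flip slot is not contained in the closure of any slot outside `p`.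
Then the family `(Φ_i)_i` is nondegenerate IFF its sub-family outside `p` is (blocks = the single pair-flip slots, each
nondegenerate and sharing no constituent with any other slot, and the rest). [cite: Gordon1999HodgeAVSurvey, 7.5–7.7 and 7.6.1]
[cite: MoonenZarhin1999LowDim, §3 (3.1)] [cite: Dodson1984, §1.1 and §5.1.2] -/
theorem isNondegenerateFamily_iff_of_pairFlip_slots (p : I → Prop) [DecidablePred p]
    (hflip : ∀ i, p i → ∀ s : K i →+* ℂ, ∃ σ : ℂ ≃+* ℂ, σ • s = (starRingAut : ℂ ≃+* ℂ) • s ∧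
      ∀ t : K i →+* ℂ, t ≠ s → t ≠ (starRingAut : ℂ ≃+* ℂ) • s → σ • t = t)
    (h1 : ∀ i j, i ≠ j → p i → p j → normalClosure ℚ (K i) ℂ ≠ normalClosure ℚ (K j) ℂ)
    (h2 : ∀ i j, p i → ¬ p j → ¬ normalClosure ℚ (K i) ℂ ≤ normalClosure ℚ (K j) ℂ) :
    CMAlgebra.IsNondegenerateFamily Φ ↔
      ((∃ i, ¬ p i) → CMAlgebra.IsNondegenerateFamily (K := fun i : {i // ¬ p i} => K i.1) fun i => Φ i.1) := by
  classical
  refine ⟨fun hΦ hex => isNondegenerateFamily_subtype hΦ (fun i => ¬ p i) hex, fun hrest => ?_⟩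
  -- blocks: `some i` for a pair-flip slot `i`, `none` for the rest
  let κ : I → Option I := fun i => if p i then some i else none
  have hκp : ∀ i, p i → κ i = some i := fun i hi => by simp only [κ, if_pos hi]
  have hκn : ∀ i, ¬ p i → κ i = none := fun i hi => by simp only [κ, if_neg hi]
  refine isNondegenerateFamily_of_fibers Φ κ (fun i j hij => ?_) (fun c hc => ?_)
  · -- slots in different blocks share no constituent
    by_cases hi : p i
    · by_cases hj : p j
      · have hne : i ≠ j := by rintro rfl; exact hij rfl
        exact (pairwise_pairFlip_pairFlip_of_normalClosure_ne (Φ := Φ) (hflip i hi) (hflip j hj) (h1 i j hne hi hj)).1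
      · obtain ⟨hirr, -, hnd⟩ := irreducible_and_finrank_eq_of_pairFlip (Φ := Φ) (hflip i hi)
        exact (pairwise_of_irreducible_of_not_normalClosure_le (Φ := Φ) (i := i) (j := j) hirr hnd (h2 i j hi hj)).1
    · by_cases hj : p j
      · obtain ⟨hirr, -, hnd⟩ := irreducible_and_finrank_eq_of_pairFlip (Φ := Φ) (hflip j hj)
        exact (pairwise_of_irreducible_of_not_normalClosure_le (Φ := Φ) (i := j) (j := i) hirr hnd (h2 j i hj hi)).2
      · exact absurd ((hκn i hi).trans (hκn j hj).symm) hij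
  · -- every block is nondegenerate
    obtain ⟨i₀, hi₀⟩ := hc
    by_cases hp0 : p i₀
    · -- the block of a pair-flip slot is the slot itself
      rw [hκp i₀ hp0] at hi₀
      subst hi₀
      haveI : Nonempty {i // κ i = some i₀} := ⟨⟨i₀, hκp i₀ hp0⟩⟩
      haveI : Subsingleton {i // κ i = some i₀} := ⟨fun a b => Subtype.ext (by
        have ha := a.2
        have hb := b.2
        by_cases hpa : p a.1
        · by_cases hpb : p b.1
          · rw [hκp _ hpa] at ha; rw [hκp _ hpb] at hb
            exact (Option.some_injective _ ha).trans (Option.some_injective _ hb).symm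
          · rw [hκn _ hpb] at hb; exact absurd hb (by simp)
        · rw [hκn _ hpa] at ha; exact absurd ha (by simp))⟩
      refine isNondegenerateFamily_of_subsingleton (K := fun i : {i // κ i = some i₀} => K i.1) (fun i => Φ i.1)
        fun i => ?_
      have hpi : p i.1 := by
        by_contra h
        have := i.2
        rw [hκn _ h] at this
        exact absurd this (by simp)
      exact (irreducible_and_finrank_eq_of_pairFlip (Φ := Φ) (hflip i.1 hpi)).2.2
    · -- the block of the rest is the sub-family outside `p`
      rw [hκn i₀ hp0] at hi₀
      subst hi₀
      let e : {i // ¬ p i} ≃ {i // κ i = none} := Equiv.subtypeEquivRight fun i => by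
        constructor
        · intro h; exact hκn i h
        · intro h hpi; rw [hκp i hpi] at h; exact absurd h (by simp)
      exact (isNondegenerateFamily_iff_of_equiv (K := fun i : {i // κ i = none} => K i.1) (fun i => Φ i.1) e).1
        (hrest ⟨i₀, hp0⟩)

/-- **ALL SLOTS PAIR-FLIP, PAIRWISE DISTINCT CLOSURES ⟹ NONDEGENERATE.**  A finite family of CM types of CM fields with
pair flips (generic CM fields of ANY degrees) whose Galois closures in `ℂ` are pairwise distinct is nondegenerate:
`Hg(∏ A_i) = ∏ Hg(A_i)` for the corresponding CM abelian varieties, of any dimensions.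
[cite: Gordon1999HodgeAVSurvey, §3 Theorem and 7.5–7.7] [cite: Dodson1984, §1.1] -/
theorem isNondegenerateFamily_pairFlip_of_normalClosure_ne
    (hflip : ∀ i, ∀ s : K i →+* ℂ, ∃ σ : ℂ ≃+* ℂ, σ • s = (starRingAut : ℂ ≃+* ℂ) • s ∧
      ∀ t : K i →+* ℂ, t ≠ s → t ≠ (starRingAut : ℂ ≃+* ℂ) • s → σ • t = t)
    (hne : ∀ i j, i ≠ j → normalClosure ℚ (K i) ℂ ≠ normalClosure ℚ (K j) ℂ) :
    CMAlgebra.IsNondegenerateFamily Φ :=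
  (isNondegenerateFamily_iff_of_pairFlip_slots (Φ := Φ) (fun _ => True) (fun i _ => hflip i)
    (fun i j hij _ _ => hne i j hij) (fun _ _ _ h => absurd trivial h)).2 fun ⟨_, h⟩ => absurd trivial h

end Types

/-! ## §2 Abelian varieties: generic CM abelian varieties of any dimensions with distinct closures -/

section Geometry

variable [Nonempty I] {A : I → AbelianVariety ℂ} {ι : ∀ i, 𝓞 (K i) →+* End (A i)}
  {θ : ∀ i, K i →+* Module.End ℂ (complexBetti (A i).X 1)}

/-- **The Hodge conjecture on every `⨁_{j<N} A_{π j}`** (every `∏ A_i^{k_i}`), with `B• = D•` there, for CM abelian varieties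
`A_i` of ANY dimensions realising types of pair-flip CM fields (generic CM fields) with pairwise distinct Galois closures —
UNCONDITIONALLY. [cite: Gordon1999HodgeAVSurvey, §3 Theorem, 7.5 and 10.10] -/
theorem hodgeConjectureFor_prod_pairFlip_of_normalClosure_ne
    (hflip : ∀ i, ∀ s : K i →+* ℂ, ∃ σ : ℂ ≃+* ℂ, σ • s = (starRingAut : ℂ ≃+* ℂ) • s ∧
      ∀ t : K i →+* ℂ, t ≠ s → t ≠ (starRingAut : ℂ ≃+* ℂ) • s → σ • t = t)
    (hne : ∀ i j, i ≠ j → normalClosure ℚ (K i) ℂ ≠ normalClosure ℚ (K j) ℂ)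
    (hA : ∀ i, IsCMTypeRealisation (Φ i) (A i) (ι i) (θ i)) {N : ℕ} (π : Fin N → I) :
    HodgeConjectureFor (⨁ fun j : Fin N => A (π j)).dim (⨁ fun j : Fin N => A (π j)).X ∧
      ∀ m : ℕ, hodgeClassSpan (⨁ fun j : Fin N => A (π j)).dim (⨁ fun j : Fin N => A (π j)).X m =
        divisorClassesSpan (⨁ fun j : Fin N => A (π j)).X (⨁ fun j : Fin N => A (π j)).dim m :=
  have h := isNondegenerateFamily_pairFlip_of_normalClosure_ne (Φ := Φ) hflip hne
  ⟨h.hodgeConjectureFor_prod hA π, fun m => h.hodgeClassSpan_prod_eq_divisorClassesSpan hA π m⟩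

/-- **No product `⨁_{j<N} A_{π j}` carries an exceptional Hodge class** in the situation of
`isNondegenerateFamily_pairFlip_of_normalClosure_ne`. [cite: Gordon1999HodgeAVSurvey, 7.5 and 7.6.1] -/
theorem not_exists_exceptional_prod_pairFlip_of_normalClosure_ne
    (hflip : ∀ i, ∀ s : K i →+* ℂ, ∃ σ : ℂ ≃+* ℂ, σ • s = (starRingAut : ℂ ≃+* ℂ) • s ∧
      ∀ t : K i →+* ℂ, t ≠ s → t ≠ (starRingAut : ℂ ≃+* ℂ) • s → σ • t = t)
    (hne : ∀ i j, i ≠ j → normalClosure ℚ (K i) ℂ ≠ normalClosure ℚ (K j) ℂ)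
    (hA : ∀ i, IsCMTypeRealisation (Φ i) (A i) (ι i) (θ i)) {N : ℕ} (π : Fin N → I) (m : ℕ) :
    ¬∃ c : complexBetti (⨁ fun j : Fin N => A (π j)).X (2 * m), IsRationalClass c ∧
        IsOfHodgeType (⨁ fun j : Fin N => A (π j)).dim (⨁ fun j : Fin N => A (π j)).X (2 * m) m m c ∧
        c ∉ divisorClassesSpan (⨁ fun j : Fin N => A (π j)).X (⨁ fun j : Fin N => A (π j)).dim m :=
  (isNondegenerateFamily_pairFlip_of_normalClosure_ne (Φ := Φ) hflip hne).not_exists_exceptional_prod hA π m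

/-- **Sextic form**: CM abelian THREEFOLDS whose sextic CM fields have Galois closures of degree `24` or `48`, pairwise
distinct — any number of them: `Hg(∏ T_i) = ∏ Hg(T_i)` and the Hodge conjecture on every `∏ T_i^{k_i}`, UNCONDITIONALLY
(no simplicity or non-isogeny hypothesis: the closures already differ). [cite: Dodson1984, §5.1.2 Theorem]
[cite: Gordon1999HodgeAVSurvey, §3 Theorem, 7.5 and 10.10] -/
theorem hodgeConjectureFor_prod_genericSextic_of_normalClosure_ne (h6 : ∀ i, finrank ℚ (K i) = 6)
    (h48 : ∀ i, finrank ℚ ↥(normalClosure ℚ (K i) ℂ) = 24 ∨ finrank ℚ ↥(normalClosure ℚ (K i) ℂ) = 48)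
    (hne : ∀ i j, i ≠ j → normalClosure ℚ (K i) ℂ ≠ normalClosure ℚ (K j) ℂ)
    (hA : ∀ i, IsCMTypeRealisation (Φ i) (A i) (ι i) (θ i)) {N : ℕ} (π : Fin N → I) :
    HodgeConjectureFor (⨁ fun j : Fin N => A (π j)).dim (⨁ fun j : Fin N => A (π j)).X ∧
      ∀ m : ℕ, hodgeClassSpan (⨁ fun j : Fin N => A (π j)).dim (⨁ fun j : Fin N => A (π j)).X m =
        divisorClassesSpan (⨁ fun j : Fin N => A (π j)).X (⨁ fun j : Fin N => A (π j)).dim m := by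
  refine hodgeConjectureFor_prod_pairFlip_of_normalClosure_ne (fun i => ?_) hne hA π
  haveI : NumberField ↥(normalClosure ℚ (K i) ℂ) := NumberField.mk
  haveI : IsNormalClosure ℚ (K i) ↥(normalClosure ℚ (K i) ℂ) :=
    Algebra.IsAlgebraic.isNormalClosure_normalClosure fun x => IsAlgClosed.splits _
  exact GenericCMField.pairFlip_of_finrank_normalClosure (h6 i) _ (h48 i)

end Geometry

/-! ## §3 Abelian varieties: the general splitting -/

section GeometrySplit

variable [Nonempty I] {A : I → AbelianVariety ℂ} {ι : ∀ i, 𝓞 (K i) →+* End (A i)}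
  {θ : ∀ i, K i →+* Module.End ℂ (complexBetti (A i).X 1)}

/-- **The Hodge conjecture on every `⨁_{j<N} A_{π j}` when the sub-family outside the pair-flip slots is nondegenerate**
(with (h1), (h2) on the closures): the generic members with distinct closures come for free — e.g. generic CM threefolds and
generic CM abelian varieties of higher dimension adjoined to any nondegenerate configuration of curves, surfaces, threefolds
(seat b16 gen 43's census) or to a single nondegenerate simple CM fourfold, as long as their closures stay outside.
UNCONDITIONAL. [cite: Gordon1999HodgeAVSurvey, §3 Theorem, 7.5–7.7 and 10.10] [cite: MoonenZarhin1999LowDim, §3 (3.1)] -/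
theorem hodgeConjectureFor_prod_of_pairFlip_slots (p : I → Prop) [DecidablePred p]
    (hflip : ∀ i, p i → ∀ s : K i →+* ℂ, ∃ σ : ℂ ≃+* ℂ, σ • s = (starRingAut : ℂ ≃+* ℂ) • s ∧
      ∀ t : K i →+* ℂ, t ≠ s → t ≠ (starRingAut : ℂ ≃+* ℂ) • s → σ • t = t)
    (h1 : ∀ i j, i ≠ j → p i → p j → normalClosure ℚ (K i) ℂ ≠ normalClosure ℚ (K j) ℂ)
    (h2 : ∀ i j, p i → ¬ p j → ¬ normalClosure ℚ (K i) ℂ ≤ normalClosure ℚ (K j) ℂ)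
    (hrest : (∃ i, ¬ p i) → CMAlgebra.IsNondegenerateFamily (K := fun i : {i // ¬ p i} => K i.1) fun i => Φ i.1)
    (hA : ∀ i, IsCMTypeRealisation (Φ i) (A i) (ι i) (θ i)) {N : ℕ} (π : Fin N → I) :
    HodgeConjectureFor (⨁ fun j : Fin N => A (π j)).dim (⨁ fun j : Fin N => A (π j)).X ∧
      ∀ m : ℕ, hodgeClassSpan (⨁ fun j : Fin N => A (π j)).dim (⨁ fun j : Fin N => A (π j)).X m =
        divisorClassesSpan (⨁ fun j : Fin N => A (π j)).X (⨁ fun j : Fin N => A (π j)).dim m :=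
  have h := (isNondegenerateFamily_iff_of_pairFlip_slots (Φ := Φ) p hflip h1 h2).2 hrest
  ⟨h.hodgeConjectureFor_prod hA π, fun m => h.hodgeClassSpan_prod_eq_divisorClassesSpan hA π m⟩

/-- **Exceptional classes live outside the pair-flip slots**: for SIMPLE, pairwise non-isogenous realisations with (h1), (h2),
some product `⨁_{j<N} A_{π j}` carries an exceptional Hodge class iff the sub-family outside `p` is degenerate.
[cite: Gordon1999HodgeAVSurvey, 7.5 (1) ⟺ (3) and 7.6.1] -/
theorem exists_exceptional_prod_iff_of_pairFlip_slots (p : I → Prop) [DecidablePred p]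
    (hflip : ∀ i, p i → ∀ s : K i →+* ℂ, ∃ σ : ℂ ≃+* ℂ, σ • s = (starRingAut : ℂ ≃+* ℂ) • s ∧
      ∀ t : K i →+* ℂ, t ≠ s → t ≠ (starRingAut : ℂ ≃+* ℂ) • s → σ • t = t)
    (h1 : ∀ i j, i ≠ j → p i → p j → normalClosure ℚ (K i) ℂ ≠ normalClosure ℚ (K j) ℂ)
    (h2 : ∀ i j, p i → ¬ p j → ¬ normalClosure ℚ (K i) ℂ ≤ normalClosure ℚ (K j) ℂ)
    (hA : ∀ i, IsCMTypeRealisation (Φ i) (A i) (ι i) (θ i)) (hS : ∀ i, (A i).IsSimple)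
    (hniso : ∀ i j, i ≠ j → ¬ AbelianVariety.IsIsogenous (A i) (A j)) :
    (∃ (N : ℕ) (π : Fin N → I) (m : ℕ) (c : complexBetti (⨁ fun j : Fin N => A (π j)).X (2 * m)),
      IsRationalClass c ∧
      IsOfHodgeType (⨁ fun j : Fin N => A (π j)).dim (⨁ fun j : Fin N => A (π j)).X (2 * m) m m c ∧
      c ∉ divisorClassesSpan (⨁ fun j : Fin N => A (π j)).X (⨁ fun j : Fin N => A (π j)).dim m) ↔
    ¬ ((∃ i, ¬ p i) → CMAlgebra.IsNondegenerateFamily (K := fun i : {i // ¬ p i} => K i.1) fun i => Φ i.1) := by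
  rw [← isNondegenerateFamily_iff_of_pairFlip_slots (Φ := Φ) p hflip h1 h2]
  constructor
  · rintro ⟨N, π, m, c, hcQ, hcH, hcD⟩ hnd
    exact hnd.not_exists_exceptional_prod hA π m ⟨c, hcQ, hcH, hcD⟩
  · intro hnd
    exact CMAlgebra.exists_exceptional_prod_of_not_isNondegenerateFamily
      (CMAlgebra.isSeparatingFamily_of_isSimple_of_pairwise_not_isIsogenous hA hS hniso) hnd hA

end GeometrySplit

end Summit.HodgeConjecture.CorCM

end
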